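import Mathlib
import HarnessLib.Audit
import Summits.PneNP.PneNP.Theorems.PstarLiteralPinning

/-!
# Dead literal patterns on a slice: feasibility is a join condition (ROUND-24, O1; memo g27 §73)

FRONTIER range-avoidance ladder, rung F-N3, ROUND 24 (cell `pnp-ideate`, prover-2 memo `g27/O1-PINNING-g27.md` §73; census node
`PstarLocalGateBudgetAssembly.LocalMenuCriterionBoundGateBudget`; restricted-model proof complexity — nothing here bears on `P` versus `NP`).

The set version of `PstarLiteralPinning.exists_false_of_no_block_join`.  For a family `K`, a first reader `w₁ = (C₁, G₁, b₁)` and a SET `Z` of AND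
variables to be switched OFF (a «dead pattern»), call an output DEAD if one of its AND variables lies in `Z` (`Dead`).  On a typed pure instance
with `C₁` off the AND variables of `K ∪ G₁`, `Z` off `C₁` and off the XOR slots of `K`, and PRIVACY for the live outputs:

* `false_of_dead_join` — a join `(D, t)` all of whose members (and, if `t`, all folds) are dead, of value `1`, excludes every point of the
  slice that vanishes on `Z`;
* **`exists_zero_on_of_no_dead_join`** — conversely, if every dead join has value `0`, the slice has a point vanishing on `Z` (one Fredholm
  alternative on (XOR values, live term values), realisation through the private variables);
* **`exists_zero_on_iff`** — so «the slice meets `{x_Z = 0}`» is the COMBINATORIAL condition «no dead join of value one».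

USE: the hypotheses `A₀ ≠ ∅` and «gate partner thawed in `A₀`» of `PstarDirtyMemberSquare` are dead-pattern feasibilities (`Z = {p}` plus the
variables to be freed), so the dirty three-block rule is decided by listing joins — on a cycle core: the cycle and the two arcs-with-folds.
-/

set_option linter.dupNamespace false -- `Summit.PneNP.PneNP.…`: summit = sub-problem name (D-0017 single-conjunct layout)

open Finset Literature.Computability.Complexity
open Summit.PneNP.PneNP.Theorems.PstarFibrePolys (bit bit_xor bit_and bit_injective)
open Summit.PneNP.PneNP.Theorems.PstarTyped (Typed)
open Summit.PneNP.PneNP.Theorems.PstarGapPeeling (eval_pure)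
open Summit.PneNP.PneNP.Theorems.PstarGapOneAll (gval)
open Summit.PneNP.PneNP.Theorems.PstarGConstraint (bit_gval)
open Summit.PneNP.PneNP.Theorems.PstarXorElimination (exists_solution_iff pairForm pairForm_apply setForm setForm_apply pdeg
  sum_pairForm_add_sum_setForm_eq_zero_iff)
open Summit.PneNP.PneNP.Theorems.PstarChordBridgeTools (xpdeg)
open Summit.PneNP.PneNP.Theorems.PstarLiteralPinning (Through InSlice IsJoin joinValue)

namespace Summit.PneNP.PneNP.Theorems.PstarDeadPatterns

variable {n m : ℕ}

/-- Output `j` is DEAD for the pattern `Z`: one of its AND variables is switched off. -/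
def Dead (I : LocalMap 4 n m) (Z : Finset (Fin n)) (j : Fin m) : Prop := ∃ v ∈ Z, Through I v j

variable {I : LocalMap 4 n m} {y : Fin m → Bool} {K : Finset (Fin m)} {w₁ : Finset (Fin n) × Finset (Fin m) × Bool} {Z : Finset (Fin n)}

/-! ## Small facts -/

/-- `bit` of an output value on a pure instance. -/
private theorem bit_eval (hI : I.IsPure xorAndPred) (z : Fin n → Bool) (j : Fin m) :
    bit (I.eval z j) = bit (z (I.vars j 0)) + bit (z (I.vars j 1)) + bit (z (I.vars j 2)) * bit (z (I.vars j 3)) := by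
  rw [eval_pure I hI, bit_xor, bit_xor, bit_and]

/-- A term through `s` vanishes where `x_s = 0`. -/
private theorem term_eq_zero_of_through {z : Fin n → Bool} {j : Fin m} {s : Fin n} (hj : Through I s j) (hs : z s = false) :
    bit (z (I.vars j 2)) * bit (z (I.vars j 3)) = 0 := by
  rcases hj with h | h
  · rw [h, hs]; simp [bit]
  · rw [h, hs]; simp [bit]

/-- Decoding `𝔽₂` to `Bool`. -/
private theorem bit_decide (a : ZMod 2) : bit (decide (a = 1)) = a := by
  revert a; decide

/-- The indicator set `T ⊆ Unit` of a Boolean, and its filter-cardinality. -/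
private theorem card_filter_unit (t : Bool) (P : Prop) [Decidable P] :
    (((univ : Finset Unit).filter fun _ => t = true).filter fun _ => P).card = if t = true ∧ P then 1 else 0 := by
  by_cases ht : t = true <;> by_cases hP : P <;> simp [ht, hP]

/-! ## A dead join of value one excludes the pattern -/

/-- **A dead join of value `1` excludes every slice point vanishing on `Z`.** -/
theorem false_of_dead_join (hI : I.IsPure xorAndPred) {D : Finset (Fin m)} {t : Bool} (hD : D ⊆ K) (hJ : IsJoin I w₁.1 D t)
    (hDs : ∀ j ∈ D, Dead I Z j) (hGs : t = true → ∀ g ∈ w₁.2.1, Dead I Z g) (hval : joinValue y w₁.2.2 D t = 1)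
    {z : Fin n → Bool} (hz : InSlice I y K w₁ z) (hzZ : ∀ v ∈ Z, z v = false) : False := by
  classical
  set x : Fin n → ZMod 2 := fun v => bit (z v) with hx
  set T : Finset Unit := univ.filter fun _ => t = true with hT
  have hzero : (∑ j ∈ D, pairForm (fun j => I.vars j 0) (fun j => I.vars j 1) j) + (∑ _k ∈ T, setForm w₁.1) = 0 := by
    refine (sum_pairForm_add_sum_setForm_eq_zero_iff _ _ D (fun _ : Unit => w₁.1) T).2 fun w => ?_
    have := hJ w
    rwa [hT, card_filter_unit]
  have happ := congrArg (fun f : (Fin n → ZMod 2) →ₗ[ZMod 2] ZMod 2 => f x) hzero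
  simp only [LinearMap.add_apply, LinearMap.coe_sum, Finset.sum_apply, pairForm_apply, setForm_apply, LinearMap.zero_apply] at happ
  have hdead : ∀ j, Dead I Z j → bit (z (I.vars j 2)) * bit (z (I.vars j 3)) = 0 := fun j ⟨v, hv, hvj⟩ =>
    term_eq_zero_of_through hvj (hzZ v hv)
  have hout : ∀ j ∈ D, x (I.vars j 0) + x (I.vars j 1) = bit (y j) := by
    intro j hj
    have := bit_eval hI z j
    rw [hz.1 j (hD hj), hdead j (hDs j hj), add_zero] at this
    exact this.symm
  have hrd : t = true → ∑ w ∈ w₁.1, x w = bit w₁.2.2 := by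
    intro ht
    have := bit_gval I w₁.1 w₁.2.1 z
    rw [hz.2, sum_eq_zero (fun g hg => hdead g (hGs ht g hg)), add_zero] at this
    exact this.symm
  have hv : joinValue y w₁.2.2 D t = ∑ j ∈ D, (x (I.vars j 0) + x (I.vars j 1)) + ∑ _k ∈ T, ∑ w ∈ w₁.1, x w := by
    unfold joinValue
    rw [sum_congr rfl hout]
    congr 1
    by_cases ht : t = true
    · rw [if_pos ht, hT, ← hrd ht]; simp [ht]
    · rw [if_neg ht, hT]; simp [ht]
  rw [hv, happ] at hval
  exact zero_ne_one hval

/-! ## No dead join of value one: a slice point vanishing on `Z` -/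

section Fredholm
open Classical in
/-- The linear form of output `j` on (XOR values, term values): `x_{u_j} + x_{v_j} + [j not dead]·u_j`. -/
private noncomputable def deadOutForm (I : LocalMap 4 n m) (Z : Finset (Fin n)) (j : Fin m) :
    ((Fin n → ZMod 2) × (Fin m → ZMod 2)) →ₗ[ZMod 2] ZMod 2 where
  toFun p := p.1 (I.vars j 0) + p.1 (I.vars j 1) + if Dead I Z j then 0 else p.2 j
  map_add' p q := by
    simp only [Prod.fst_add, Prod.snd_add, Pi.add_apply]
    split_ifs <;> ring
  map_smul' r p := by
    simp only [Prod.smul_fst, Prod.smul_snd, Pi.smul_apply, smul_eq_mul, RingHom.id_apply]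
    split_ifs <;> ring

open Classical in
/-- The linear form of the reader `(C₁, G₁)`: `Σ_{w ∈ C₁} x_w + Σ_{g ∈ G₁ not dead} u_g`. -/
private noncomputable def deadRdForm (I : LocalMap 4 n m) (Z : Finset (Fin n)) (C₁ : Finset (Fin n)) (G₁ : Finset (Fin m)) :
    ((Fin n → ZMod 2) × (Fin m → ZMod 2)) →ₗ[ZMod 2] ZMod 2 where
  toFun p := ∑ w ∈ C₁, p.1 w + ∑ g ∈ G₁.filter (fun g => ¬ Dead I Z g), p.2 g
  map_add' p q := by
    simp only [Prod.fst_add, Prod.snd_add, Pi.add_apply, sum_add_distrib]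
    ring
  map_smul' r p := by
    simp only [Prod.smul_fst, Prod.smul_snd, Pi.smul_apply, smul_eq_mul, RingHom.id_apply]
    rw [mul_add, mul_sum, mul_sum]

open Classical in
/-- Evaluation of the output form. -/
private theorem deadOutForm_apply (I : LocalMap 4 n m) (Z : Finset (Fin n)) (j : Fin m) (p : (Fin n → ZMod 2) × (Fin m → ZMod 2)) :
    deadOutForm I Z j p = p.1 (I.vars j 0) + p.1 (I.vars j 1) + if Dead I Z j then 0 else p.2 j := rfl

open Classical in
/-- Evaluation of the reader form. -/
private theorem deadRdForm_apply (I : LocalMap 4 n m) (Z : Finset (Fin n)) (C₁ : Finset (Fin n)) (G₁ : Finset (Fin m))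
    (p : (Fin n → ZMod 2) × (Fin m → ZMod 2)) :
    deadRdForm I Z C₁ G₁ p = ∑ w ∈ C₁, p.1 w + ∑ g ∈ G₁.filter (fun g => ¬ Dead I Z g), p.2 g := rfl

end Fredholm

/-- **NO DEAD JOIN OF VALUE ONE ⇒ A SLICE POINT VANISHING ON `Z`.**  Typed pure instance; `K` and `G₁` disjoint; `C₁` off the AND variables of
`K ∪ G₁`; `Z` off `C₁` and off the XOR slots of `K`; PRIVACY: every live output of `K ∪ G₁` has an AND variable occurring in no other AND slot of
`K ∪ G₁`.  If every dead join has value `0`, some point of the slice vanishes on `Z`. -/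
theorem exists_zero_on_of_no_dead_join [Nonempty (Fin n)] (hI : I.IsPure xorAndPred) (hT : Typed I) (hKG : Disjoint K w₁.2.1)
    (hC₁ : ∀ v ∈ w₁.1, ∀ j ∈ K ∪ w₁.2.1, ¬ Through I v j) (hZX : ∀ v ∈ Z, ∀ j ∈ K, I.vars j 0 ≠ v ∧ I.vars j 1 ≠ v)
    (hZC : ∀ v ∈ Z, v ∉ w₁.1)
    (hfree : ∀ j ∈ K ∪ w₁.2.1, ¬ Dead I Z j → ∃ p, Through I p j ∧ ∀ j' ∈ K ∪ w₁.2.1, Through I p j' → j' = j)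
    (hno : ∀ D ⊆ K, ∀ t : Bool, IsJoin I w₁.1 D t → (∀ j ∈ D, Dead I Z j) → (t = true → ∀ g ∈ w₁.2.1, Dead I Z g) →
      joinValue y w₁.2.2 D t ≠ 1) :
    ∃ z, InSlice I y K w₁ z ∧ ∀ v ∈ Z, z v = false := by
  classical
  obtain ⟨C₁, G₁, b₁⟩ := w₁
  simp only at hKG hC₁ hZC hfree hno ⊢
  set F := K ∪ G₁ with hF
  have e01 : ∀ a : ZMod 2, a ≠ 1 → a = 0 := by decide
  -- STEP 1: the linear system in (XOR values, term values) is solvable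
  let L : Fin m ⊕ Unit → ((Fin n → ZMod 2) × (Fin m → ZMod 2)) →ₗ[ZMod 2] ZMod 2 :=
    fun i => Sum.elim (deadOutForm I Z) (fun _ => deadRdForm I Z C₁ G₁) i
  let c : Fin m ⊕ Unit → ZMod 2 := fun i => Sum.elim (fun j => bit (y j)) (fun _ => bit b₁) i
  have hsolv : ∃ p, ∀ i ∈ K.disjSum (univ : Finset Unit), L i p = c i := by
    rw [exists_solution_iff]
    intro E hE hL
    obtain ⟨D, T, rfl⟩ : ∃ D T, E = D.disjSum T := ⟨E.toLeft, E.toRight, Finset.toLeft_disjSum_toRight.symm⟩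
    have hD : D ⊆ K := fun j hj => Finset.inl_mem_disjSum.1 (hE (Finset.inl_mem_disjSum.2 hj))
    rw [Finset.sum_disjSum] at hL ⊢
    -- evaluate the dependency at test vectors
    have hev : ∀ p, ∑ j ∈ D, deadOutForm I Z j p + ∑ k ∈ T, deadRdForm I Z C₁ G₁ p = 0 := fun p => by
      have := congrArg (fun f : ((Fin n → ZMod 2) × (Fin m → ZMod 2)) →ₗ[ZMod 2] ZMod 2 => f p) hL
      simpa only [L, Sum.elim_inl, Sum.elim_inr, LinearMap.add_apply, LinearMap.coe_sum, Finset.sum_apply, LinearMap.zero_apply]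
        using this
    -- (a) `(D, t)` is a join, `t := (() ∈ T)`
    have hTsub : T = univ.filter fun _ => decide (() ∈ T) = true := by
      ext u; cases u; by_cases h : () ∈ T <;> simp [h]
    have hjoin : IsJoin I C₁ D (decide (() ∈ T)) := by
      have hz : (∑ j ∈ D, pairForm (fun j => I.vars j 0) (fun j => I.vars j 1) j) + (∑ _k ∈ T, setForm C₁) = 0 := by
        apply LinearMap.ext; intro x
        have := hev (x, 0)
        simpa only [LinearMap.add_apply, LinearMap.coe_sum, Finset.sum_apply, pairForm_apply, setForm_apply, deadOutForm_apply, deadRdForm_apply,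
          Prod.fst, Prod.snd, Pi.zero_apply, ite_self, add_zero, sum_const_zero, LinearMap.zero_apply] using this
      intro w
      have := (sum_pairForm_add_sum_setForm_eq_zero_iff _ _ D (fun _ : Unit => C₁) T).1 hz w
      rwa [hTsub, card_filter_unit] at this
    -- (b) every member of `D` is dead
    have hDs : ∀ j ∈ D, Dead I Z j := by
      intro j hj
      by_contra hns
      have hjG : j ∉ G₁ := fun h => disjoint_left.1 hKG (hD hj) h
      have := hev (0, Pi.single j 1)
      have h1 : ∑ j' ∈ D, deadOutForm I Z j' ((0 : Fin n → ZMod 2), (Pi.single j (1 : ZMod 2) : Fin m → ZMod 2)) = 1 := by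
        rw [sum_eq_single_of_mem j hj fun j' hj' hne => ?_]
        · simp [deadOutForm_apply, hns]
        · simp [deadOutForm_apply, hne]
      have h2 : ∑ _k ∈ T, deadRdForm I Z C₁ G₁ ((0 : Fin n → ZMod 2), (Pi.single j (1 : ZMod 2) : Fin m → ZMod 2)) = 0 := by
        refine sum_eq_zero fun k _ => ?_
        rw [deadRdForm_apply]
        simp only [Pi.zero_apply, sum_const_zero, zero_add]
        refine sum_eq_zero fun g hg => ?_
        have hne : g ≠ j := fun h => hjG (h ▸ (mem_filter.1 hg).1)
        simp [hne]
      rw [h1, h2, add_zero] at this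
      exact one_ne_zero this
    -- (c) with the reader, every fold is dead
    have hGs : decide (() ∈ T) = true → ∀ g ∈ G₁, Dead I Z g := by
      intro hT g hg
      rw [decide_eq_true_eq] at hT
      by_contra hns
      have hgK : g ∉ K := fun h => disjoint_left.1 hKG h hg
      have := hev (0, Pi.single g 1)
      have h1 : ∑ j' ∈ D, deadOutForm I Z j' ((0 : Fin n → ZMod 2), (Pi.single g (1 : ZMod 2) : Fin m → ZMod 2)) = 0 := by
        refine sum_eq_zero fun j' hj' => ?_
        have hne : j' ≠ g := fun h => hgK (h ▸ hD hj')
        simp [deadOutForm_apply, hne]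
      have h2 : ∑ _k ∈ T, deadRdForm I Z C₁ G₁ ((0 : Fin n → ZMod 2), (Pi.single g (1 : ZMod 2) : Fin m → ZMod 2)) = 1 := by
        have hT1 : T = {()} := by ext u; cases u; simp [hT]
        rw [hT1, sum_singleton, deadRdForm_apply]
        simp only [Pi.zero_apply, sum_const_zero, zero_add]
        rw [sum_eq_single_of_mem g (mem_filter.2 ⟨hg, hns⟩) fun g' _ hne => by rw [Pi.single_apply, if_neg hne]]
        simp
      rw [h1, h2, zero_add] at this
      exact one_ne_zero this
    -- hence the right-hand sides sum to the value of a dead join, which is `0`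
    have hv := e01 _ (hno D hD _ hjoin hDs hGs)
    unfold joinValue at hv
    have hc : ∑ j ∈ D, c (Sum.inl j) + ∑ k ∈ T, c (Sum.inr k) = joinValue y b₁ D (decide (() ∈ T)) := by
      unfold joinValue
      simp only [c, Sum.elim_inl, Sum.elim_inr, sum_const]
      congr 1
      by_cases h : () ∈ T
      · have hT1 : T = {()} := by ext u; cases u; simp [h]
        simp [hT1]
      · have hT0 : T = ∅ := by ext u; cases u; simp [h]
        simp [hT0]
    rw [hc]
    unfold joinValue
    exact hv
  obtain ⟨⟨x, u⟩, hxu⟩ := hsolv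
  have hxK : ∀ j ∈ K, x (I.vars j 0) + x (I.vars j 1) + (if Dead I Z j then 0 else u j) = bit (y j) := fun j hj => by
    have := hxu (Sum.inl j) (Finset.inl_mem_disjSum.2 hj)
    simpa only [L, c, Sum.elim_inl, deadOutForm_apply] using this
  have hxR : ∑ w ∈ C₁, x w + ∑ g ∈ G₁.filter (fun g => ¬ Dead I Z g), u g = bit b₁ := by
    have := hxu (Sum.inr ()) (Finset.inr_mem_disjSum.2 (mem_univ _))
    simpa only [L, c, Sum.elim_inr, deadRdForm_apply] using this
  -- STEP 2: realise the term values through the private variables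
  choose! pv hpv hpriv using hfree
  let z : Fin n → Bool := fun w =>
    if w ∈ Z then false
    else if h : ∃ j, j ∈ F ∧ ¬ Dead I Z j ∧ pv j = w then decide (u h.choose = 1)
    else if ∃ j ∈ F, Through I w j then true
    else decide (x w = 1)
  have hzZ : ∀ v ∈ Z, z v = false := fun v hv => by simp [z, hv]
  -- AND variables of `F` are neither XOR variables of `K` nor in `C₁` (typed; hypothesis)
  have hand_not_xor : ∀ j ∈ F, ∀ w, Through I w j → ∀ j' ∈ K, I.vars j' 0 ≠ w ∧ I.vars j' 1 ≠ w := by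
    intro j _ w hw j' _
    rcases hw with h | h
    · exact ⟨fun e => hT j' j 0 2 (by decide) (by decide) (e.trans h.symm), fun e => hT j' j 1 2 (by decide) (by decide) (e.trans h.symm)⟩
    · exact ⟨fun e => hT j' j 0 3 (by decide) (by decide) (e.trans h.symm), fun e => hT j' j 1 3 (by decide) (by decide) (e.trans h.symm)⟩
  -- the value of `z` at a live variable that is no AND variable of `F`
  have hz_free : ∀ w, w ∉ Z → (∀ j ∈ F, ¬ Through I w j) → z w = decide (x w = 1) := by
    intro w hws hno'
    have h2 : ¬ ∃ j, j ∈ F ∧ ¬ Dead I Z j ∧ pv j = w := by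
      rintro ⟨j, hj, hns, hpj⟩
      exact hno' j hj (hpj ▸ hpv j hj hns)
    have h3 : ¬ ∃ j ∈ F, Through I w j := by
      rintro ⟨j, hj, hw⟩; exact hno' j hj hw
    simp only [z, if_neg hws, dif_neg h2, if_neg h3]
  -- the private variable of a live output carries its term value
  have hz_pv : ∀ j ∈ F, ¬ Dead I Z j → z (pv j) = decide (u j = 1) := by
    intro j hj hns
    have hne : pv j ∉ Z := fun e => hns ⟨pv j, e, hpv j hj hns⟩
    have hex : ∃ j', j' ∈ F ∧ ¬ Dead I Z j' ∧ pv j' = pv j := ⟨j, hj, hns, rfl⟩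
    have hch : hex.choose = j := by
      obtain ⟨hj', hns', hpj'⟩ := hex.choose_spec
      have hth := hpv _ hj' hns'
      rw [hpj'] at hth
      exact hpriv j hj hns _ hj' hth
    simp only [z, if_neg hne, dif_pos hex, hch]
  -- the other AND variable of such an output is set to `1`
  have hz_other : ∀ j ∈ F, ¬ Dead I Z j → ∀ w, Through I w j → w ≠ pv j → z w = true := by
    intro j hj hns w hw hwp
    have hws : w ∉ Z := fun e => hns ⟨w, e, hw⟩
    have h2 : ¬ ∃ j', j' ∈ F ∧ ¬ Dead I Z j' ∧ pv j' = w := by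
      rintro ⟨j', hj', hns', hpj'⟩
      have : j = j' := hpriv j' hj' hns' j hj (hpj' ▸ hw)
      subst this
      exact hwp hpj'.symm
    have h3 : ∃ j ∈ F, Through I w j := ⟨j, hj, hw⟩
    simp only [z, if_neg hws, dif_neg h2, if_pos h3]
  -- term values
  have hterm : ∀ j ∈ F, bit (z (I.vars j 2)) * bit (z (I.vars j 3)) = if Dead I Z j then 0 else u j := by
    intro j hj
    by_cases hs : Dead I Z j
    · rw [if_pos hs]
      obtain ⟨v, hv, hvj⟩ := hs
      exact term_eq_zero_of_through hvj (hzZ v hv)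
    rw [if_neg hs]
    have h23 : I.vars j 2 ≠ I.vars j 3 := fun e => absurd (hI.2 j e) (by decide)
    rcases hpv j hj hs with h | h
    · rw [h, hz_pv j hj hs, hz_other j hj hs (I.vars j 3) (Or.inr rfl) (fun e => h23 (h.trans e.symm)), bit_decide]
      simp [bit]
    · rw [h, hz_pv j hj hs, hz_other j hj hs (I.vars j 2) (Or.inl rfl) (fun e => h23 (e.trans h.symm)), bit_decide]
      simp [bit]
  -- XOR variables of `K` and the variables of `C₁` follow `x`
  have hxor : ∀ j ∈ K, ∀ σ : Fin 4, σ = 0 ∨ σ = 1 → bit (z (I.vars j σ)) = x (I.vars j σ) := by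
    intro j hj σ hσ
    have hws : I.vars j σ ∉ Z := fun hv => by
      rcases hσ with rfl | rfl; exacts [(hZX _ hv j hj).1 rfl, (hZX _ hv j hj).2 rfl]
    have hno' : ∀ j' ∈ F, ¬ Through I (I.vars j σ) j' := by
      intro j' hj' hw
      have := hand_not_xor j' hj' _ hw j hj
      rcases hσ with rfl | rfl; exacts [this.1 rfl, this.2 rfl]
    rw [hz_free _ hws hno', bit_decide]
  have hC : ∀ w ∈ C₁, bit (z w) = x w := by
    intro w hw
    have hws : w ∉ Z := fun hv => hZC w hv hw
    rw [hz_free w hws (fun j hj => hC₁ w hw j hj), bit_decide]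
  refine ⟨z, ⟨fun j hj => ?_, ?_⟩, hzZ⟩
  · apply bit_injective
    rw [bit_eval hI, hxor j hj 0 (Or.inl rfl), hxor j hj 1 (Or.inr rfl), hterm j (mem_union_left _ hj), hxK j hj]
  · apply bit_injective
    rw [bit_gval, sum_congr rfl hC, sum_congr rfl fun g hg => hterm g (mem_union_right _ hg), ← hxR, sum_filter]
    congr 1
    exact sum_congr rfl fun g _ => by by_cases h : Dead I Z g <;> simp [h]


/-- **PATTERN FEASIBILITY IS A JOIN CONDITION.**  Under the hypotheses of `exists_zero_on_of_no_dead_join`: the slice has a point vanishing on `Z`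
iff no dead join has value `1`. -/
theorem exists_zero_on_iff [Nonempty (Fin n)] (hI : I.IsPure xorAndPred) (hT : Typed I) (hKG : Disjoint K w₁.2.1)
    (hC₁ : ∀ v ∈ w₁.1, ∀ j ∈ K ∪ w₁.2.1, ¬ Through I v j) (hZX : ∀ v ∈ Z, ∀ j ∈ K, I.vars j 0 ≠ v ∧ I.vars j 1 ≠ v)
    (hZC : ∀ v ∈ Z, v ∉ w₁.1)
    (hfree : ∀ j ∈ K ∪ w₁.2.1, ¬ Dead I Z j → ∃ p, Through I p j ∧ ∀ j' ∈ K ∪ w₁.2.1, Through I p j' → j' = j) :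
    (∃ z, InSlice I y K w₁ z ∧ ∀ v ∈ Z, z v = false) ↔
      ∀ D ⊆ K, ∀ t : Bool, IsJoin I w₁.1 D t → (∀ j ∈ D, Dead I Z j) → (t = true → ∀ g ∈ w₁.2.1, Dead I Z g) →
        joinValue y w₁.2.2 D t ≠ 1 :=
  ⟨fun ⟨_, hz, hzZ⟩ _ hD _ hJ hDs hGs hval => false_of_dead_join hI hD hJ hDs hGs hval hz hzZ,
    exists_zero_on_of_no_dead_join hI hT hKG hC₁ hZX hZC hfree⟩

end Summit.PneNP.PneNP.Theorems.PstarDeadPatterns
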